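import Summits.Ventures.AbcSig.Rows.TemplateC
import Summits.Ventures.AbcSig.Recipes.BS04PackageParts

/-!
# Venture AbcSig — ROW TEMPLATES FROM THE PRIMITIVE PACKAGES: `xⁿ + yⁿ = C z²`, fixed `n`, Kraus tables GENERATED (no table hypothesis)

HONEST FRAMING. Fully PROVED template theorems of the COMPUTATION cell `pub-abcsig`; CONDITIONAL on named hypotheses, no claim on ABC or
any summit. Variant of `Rows/TemplateKraus.lean` (`row_template_refined_even/odd`) in which
* the exponent-specific allowed-trace table is not DATA with a `RefinedTraces` hypothesis (CITED recipe + COMPUTED table) but the VALUE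
  `krausTableAt μ 1 1 C n aux` of the computable generator (`Recipes/KrausTable.lean`), for ANY list `aux` of auxiliary primes, whose
  soundness for actual solutions is the theorem `freyTrace_mem_krausTable` and whose coarse part is [BS04, Lemma 4.2] proved
  (`Recipes/FreyTracePackage.lean`, `Recipes/FreyTraceLemma42.lean`);
* `BS04Package` is replaced by its clause (1) `BS04ExistencePackage` ([BS04, Lemma 3.3]) and the trace package `FreyTracePackage`
  ([BS04, (3.1) + p. 27]) — at the Serre level no `LevelDividesPackage` is needed;
* the per-orbit alternative to a kernel certificate may be a standing exclusion `ExcludesStd` (as produced by `Recipes/EisPackage.lean` &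
  co.) or a cited family exclusion `Excludes` (as before).
A row instantiating these templates has as trust base: existence (L3.3), the trace identity ((3.1) + the printed curves), `DataComplete`
(computed), and the cited per-orbit exclusions it names — and NO computed trace table. Certificates must be checked against
`krausTableAt μ 1 1 C n aux` (the generator's value; `Recipes/KrausTableCheck.lean` shows it reproduces the tables of record).

Reference: [BS04] Bennett–Skinner, Canad. J. Math. 56 (2004); A. Kraus, Canad. J. Math. 49 (1997).
-/

namespace Summit.Ventures.AbcSig

/-! ## Glue: complete orbit data + (certificate ∨ standing exclusion ∨ family exclusion) per orbit -/

/-- Level-wide glue in STANDING form: if the orbit list is complete for level `N` and every listed orbit has well-formed entries and is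
sieve-eliminated for `S.n` against the table `A`, or carries a standing-datum exclusion (`ExcludesStd`, e.g. from `EisPackage`), or a
cited family exclusion containing `S`, then no newform of level `N` has `ρ^E_n` (for the standing datum `S`) arising from it while
satisfying the trace congruences against `A`. -/
theorem NewformModel.no_newform_arises_std (M : NewformModel) {N : ℕ} (orbits : List OrbitData)
    (hdata : M.DataComplete N orbits) (fam : FreyDatum → Prop) (S : FreyDatum) (κ : FreyCase) (hS : Standing S κ) (hfam : fam S)
    (A : ℕ → List ℤ)
    (h : ∀ o ∈ orbits, (∀ e ∈ o.coeffs, e.ell.Prime ∧ e.ell ≠ 2 ∧ ¬ e.ell ∣ N) ∧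
      (o.Eliminated A S.n ∨ M.ExcludesStd N o S.n ∨ M.Excludes N o fam))
    (f : M.Form N) (harises : M.Arises S N f) (hmod : M.ArisesMod f S.n A) : False := by
  obtain ⟨o, ho, hfo⟩ := hdata f
  obtain ⟨hgood, helim | hstd | hex⟩ := h o ho
  · exact M.not_arisesMod_of_eliminated f o hfo S.n A helim hgood hmod
  · exact hstd S κ hS rfl f hfo harises
  · exact hex S hfam f hfo harises

/-! ## Row templates from the PRIMITIVE packages: no table hypothesis -/

/-- **Row template from the parts, `xy` even** (level `2C²`, family "`(1,1,C)`, exponent `n`, `xy` even", Kraus tables GENERATED: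
`krausTableAt E₃ 1 1 C n aux` for ANY list `aux` of auxiliary primes). Hypotheses: the existence package ([BS04, Lemma 3.3]), the trace
package ([BS04, (3.1) + p. 27]), complete orbit data at `2C²` (COMPUTED), and per orbit a kernel certificate against the generated table,
or a standing exclusion, or a cited family exclusion. Compared with `row_template_refined_even` (`Rows/TemplateKraus.lean`): no
`RefinedTraces` hypothesis (the table is sound by `freyTrace_mem_krausTable` + [BS04, Lemma 4.2] proved), and `BS04Package` replaced by
its clause (1). -/
theorem row_template_parts_even (C : ℕ) (hsq : Squarefree C) (hCodd : Odd C) (M : NewformModel)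
    (h₁ : M.BS04ExistencePackage) (h₃ : M.FreyTracePackage) {orbsE : List OrbitData} (hDE : M.DataComplete (2 * C ^ 2) orbsE)
    (n : ℕ) (hn : n.Prime) (h7 : 7 ≤ n) (hnC : ¬ n ∣ C) (aux : List ℕ)
    (hE : ∀ o ∈ orbsE, (∀ e ∈ o.coeffs, e.ell.Prime ∧ e.ell ≠ 2 ∧ ¬ e.ell ∣ 2 * C ^ 2) ∧
      (o.Eliminated (krausTableAt .E3 1 1 C n aux) n ∨ M.ExcludesStd (2 * C ^ 2) o n ∨
        M.Excludes (2 * C ^ 2) o (fun S => S.A = 1 ∧ S.B = 1 ∧ S.C = C ∧ S.n = n ∧ 2 ∣ S.a * S.b)))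
    (a b c : ℤ) (heven : 2 ∣ a * b) : ¬ IsPrimitiveSolution 1 1 C n a b c := by
  intro hsol
  have hCpos : 0 < C := hCodd.pos
  have hCoddZ : ¬ 2 ∣ (C : ℤ) := by
    intro h
    have h' : (2 : ℕ) ∣ C := by exact_mod_cast h
    exact (Nat.not_even_iff_odd.mpr hCodd) (even_iff_two_dvd.mpr h')
  obtain ⟨a', b', hsol', hb', hab'⟩ :
      ∃ a' b' : ℤ, IsPrimitiveSolution 1 1 C n a' b' c ∧ 2 ∣ b' ∧ a' * b' = a * b := by
    rcases Int.prime_two.dvd_mul.mp heven with h2 | h2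
    · exact ⟨b, a, hsol.swap, h2, mul_comm _ _⟩
    · exact ⟨a, b, hsol, h2, rfl⟩
  have hc2 : ¬ 2 ∣ c := by
    intro h2c
    obtain ⟨-, -, -, -, -, -, hbc⟩ := hsol'
    have hu := hbc.isUnit_of_dvd' (by simpa using hb') (Dvd.dvd.mul_left h2c _)
    rcases Int.isUnit_iff.mp hu with h | h <;> omega
  obtain ⟨c', hc'sgn, hc'⟩ := exists_sign_sub_four_dvd c C hc2 hCoddZ
  have hsol'' : IsPrimitiveSolution 1 1 C n a' b' c' := hsol'.of_sign hc'sgn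
  have hcase : FreyCase.Holds .v₇ 1 1 C n a' b' c' := by
    refine ⟨?_, hc'⟩
    have h2n : (2 : ℤ) ^ 7 ∣ b' ^ n := (pow_dvd_pow 2 h7).trans (pow_dvd_pow_of_dvd hb' n)
    simpa using h2n
  have hndvd : ¬ n ∣ 1 * 1 * C := by simpa using hnC
  have hfree : ∀ q : ℕ, q.Prime → ¬ q ^ n ∣ 1 ∧ ¬ q ^ n ∣ 1 := by
    intro q hq
    have : ¬ q ^ n ∣ 1 := by
      intro h
      have h1 := Nat.dvd_one.mp h
      rw [Nat.pow_eq_one] at h1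
      rcases h1 with h1 | h1
      · exact hq.one_lt.ne' h1
      · omega
    exact ⟨this, this⟩
  have hab1 : a' * b' ≠ 1 := by
    intro h; rw [h] at hab'; omega
  have hab2 : a' * b' ≠ -1 := by
    intro h; rw [h] at hab'; omega
  have hS : Standing ⟨1, 1, C, n, a', b', c'⟩ .v₇ :=
    ⟨one_pos, one_pos, hCpos, hsq, hn, h7, hndvd, hfree, hsol'', hab1, hab2, hcase⟩
  have hlev : bs04Level .v₇ 1 1 C n = 2 * C ^ 2 := (bs04Level_one_one C n hsq hCodd hnC).1
  obtain ⟨f, hf⟩ := h₁ ⟨1, 1, C, n, a', b', c'⟩ .v₇ hS (2 * C ^ 2) hlev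
  have heven' : 2 ∣ a' * b' := by rw [hab']; exact heven
  have hmod : M.ArisesMod f n (krausTableAt .E3 1 1 C n aux) :=
    h₃.arisesMod_krausTableAt_level ⟨1, 1, C, n, a', b', c'⟩ .v₇ hS (2 * C ^ 2) hlev f hf aux
  exact M.no_newform_arises_std orbsE hDE (fun S => S.A = 1 ∧ S.B = 1 ∧ S.C = C ∧ S.n = n ∧ 2 ∣ S.a * S.b)
    ⟨1, 1, C, n, a', b', c'⟩ .v₇ hS ⟨rfl, rfl, rfl, rfl, heven'⟩ _ hE f hf hmod

/-- **Row template from the parts, `xy` odd** (level `32C²`, family "`(1,1,C)`, exponent `n`, `xy` odd", Kraus tables GENERATED: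
`krausTableAt E₁ 1 1 C n aux`). As `row_template_parts_even`, in case (i) after the WLOG swap (`case_i_or_swap`). -/
theorem row_template_parts_odd (C : ℕ) (hC3 : 3 ≤ C) (hsq : Squarefree C) (hCodd : Odd C) (M : NewformModel)
    (h₁ : M.BS04ExistencePackage) (h₃ : M.FreyTracePackage) {orbsO : List OrbitData} (hDO : M.DataComplete (32 * C ^ 2) orbsO)
    (n : ℕ) (hn : n.Prime) (h7 : 7 ≤ n) (hnC : ¬ n ∣ C) (aux : List ℕ)
    (hO : ∀ o ∈ orbsO, (∀ e ∈ o.coeffs, e.ell.Prime ∧ e.ell ≠ 2 ∧ ¬ e.ell ∣ 32 * C ^ 2) ∧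
      (o.Eliminated (krausTableAt .E1 1 1 C n aux) n ∨ M.ExcludesStd (32 * C ^ 2) o n ∨
        M.Excludes (32 * C ^ 2) o (fun S => S.A = 1 ∧ S.B = 1 ∧ S.C = C ∧ S.n = n ∧ ¬ 2 ∣ S.a * S.b)))
    (a b c : ℤ) (hodd : ¬ 2 ∣ a * b) : ¬ IsPrimitiveSolution 1 1 C n a b c := by
  intro hsol
  have hCpos : 0 < C := hCodd.pos
  have hnodd : Odd n := hn.odd_of_ne_two (by omega)
  have hCoddZ : ¬ 2 ∣ (C : ℤ) := by
    intro h
    have h' : (2 : ℕ) ∣ C := by exact_mod_cast h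
    exact (Nat.not_even_iff_odd.mpr hCodd) (even_iff_two_dvd.mpr h')
  have heq : a ^ n + b ^ n = C * c ^ 2 := by simpa using hsol.1
  have hCc : (C : ℤ) * c ≠ 0 := by simpa using hsol.2.2.2.1
  by_cases htriv : a * b = 1 ∨ a * b = -1
  · exact no_trivial_solution C hC3 n hnodd a b c htriv hCc heq
  have hab1 : a * b ≠ 1 := fun h => htriv (Or.inl h)
  have hab2 : a * b ≠ -1 := fun h => htriv (Or.inr h)
  have hodd5 : ¬ 2 ∣ a * b * (1 : ℕ) * (1 : ℕ) * (C : ℕ) := by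
    intro h
    have h' : (2 : ℤ) ∣ a * b * C := by simpa using h
    rcases Int.prime_two.dvd_mul.mp h' with h2 | h2
    · exact hodd h2
    · exact hCoddZ h2
  have hndvd : ¬ n ∣ 1 * 1 * C := by simpa using hnC
  have hfree : ∀ q : ℕ, q.Prime → ¬ q ^ n ∣ 1 ∧ ¬ q ^ n ∣ 1 := by
    intro q hq
    have : ¬ q ^ n ∣ 1 := by
      intro h
      have h1 := Nat.dvd_one.mp h
      rw [Nat.pow_eq_one] at h1
      rcases h1 with h1 | h1
      · exact hq.one_lt.ne' h1
      · omega
    exact ⟨this, this⟩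
  have hL : bs04Level .i 1 1 C n = 32 * C ^ 2 := (bs04Level_one_one C n hsq hCodd hnC).2
  let fam : FreyDatum → Prop := fun S => S.A = 1 ∧ S.B = 1 ∧ S.C = C ∧ S.n = n ∧ ¬ 2 ∣ S.a * S.b
  rcases case_i_or_swap hsol hnodd hodd5 with hcase | hcase
  · have hS : Standing ⟨1, 1, C, n, a, b, c⟩ .i := ⟨one_pos, one_pos, hCpos, hsq, hn, h7, hndvd, hfree, hsol, hab1, hab2, hcase⟩
    obtain ⟨f, hf⟩ := h₁ ⟨1, 1, C, n, a, b, c⟩ .i hS (32 * C ^ 2) hL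
    have hmod : M.ArisesMod f n (krausTableAt .E1 1 1 C n aux) :=
      h₃.arisesMod_krausTableAt_level ⟨1, 1, C, n, a, b, c⟩ .i hS (32 * C ^ 2) hL f hf aux
    exact M.no_newform_arises_std orbsO hDO fam ⟨1, 1, C, n, a, b, c⟩ .i hS ⟨rfl, rfl, rfl, rfl, hodd⟩ _ hO f hf hmod
  · have hodd' : ¬ 2 ∣ b * a := by rw [mul_comm]; exact hodd
    have hba1 : b * a ≠ 1 := by rw [mul_comm]; exact hab1
    have hba2 : b * a ≠ -1 := by rw [mul_comm]; exact hab2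
    have hS : Standing ⟨1, 1, C, n, b, a, c⟩ .i :=
      ⟨one_pos, one_pos, hCpos, hsq, hn, h7, hndvd, hfree, hsol.swap, hba1, hba2, hcase⟩
    obtain ⟨f, hf⟩ := h₁ ⟨1, 1, C, n, b, a, c⟩ .i hS (32 * C ^ 2) hL
    have hmod : M.ArisesMod f n (krausTableAt .E1 1 1 C n aux) :=
      h₃.arisesMod_krausTableAt_level ⟨1, 1, C, n, b, a, c⟩ .i hS (32 * C ^ 2) hL f hf aux
    exact M.no_newform_arises_std orbsO hDO fam ⟨1, 1, C, n, b, a, c⟩ .i hS ⟨rfl, rfl, rfl, rfl, hodd'⟩ _ hO f hf hmod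

end Summit.Ventures.AbcSig
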